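import Summits.ResolutionOfSingularities.ResolutionOfSingularities.Theorems.DescentDescentPerfectToAllTrdegOne
import Mathlib.RingTheory.AlgebraicIndependent.TranscendenceBasis
import Mathlib.FieldTheory.Finite.Basic
import Mathlib.FieldTheory.Perfect

/-!
# `DescentPerfectToAll` (stmt-ResolutionOfSingularities-0549) for ALL ground fields of transcendence degree
# `≤ 1` over the prime field

Route `ResolutionOfSingularities/Descent`, crux `DescentPerfectToAll`. Helper (OURS; not a statement of any
manuscript). `DescentDescentPerfectToAllTrdegOne.lean` proves the crux's conclusion for ground fields `k`
algebraic over `𝔽_p(t)` with `t ∉ k^p`. This file supplies the bookkeeping that turns it into the clean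
statement «`trdeg_{𝔽_p} k ≤ 1`» (Mathlib's `Algebra.trdeg` over the prime subfield `⊥ : Subfield k`):

* `perfectField_or_exists_of_trdeg_le_one` — a field of characteristic `p` with `trdeg (⊥ : Subfield k) k ≤ 1`
  is either perfect, or algebraic over `closure {t}` for some `t ∉ k^p` (such a `t` is transcendental over
  the finite prime field — Frobenius is onto on the finite ring `𝔽_p[t]` otherwise — hence a transcendence
  basis by the dimension count `Algebra.trdeg ≤ 1`).
* `descentPerfectToAll_trdeg_le_one` — **resolution over all perfect fields of characteristic `p` implies
  resolution of every reduced separated scheme of finite type over every ground field of transcendence degree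
  `≤ 1` over `𝔽_p`** (all dimensions).

Scope note (docstring revised 2026-08-26 after a wrong example was posted): together with the tree's
`Theorems.hasResolution_of_perfectRes_of_essFiniteType` (fields essentially of finite type over a perfect field —
this covers e.g. `𝔽_p(t)(u^{1/p^∞}) = 𝔽_p(u^{1/p^∞})(t)`) and
`Theorems.hasResolution_of_perfectRes_of_isSeparable_fg`, the residual of stmt-0549 is the class of ground fields
separable over no subfield essentially of finite type over a perfect subfield; standing witness `𝔽_p((t))`.
-/

noncomputable section

set_option linter.dupNamespace false -- mandated namespace of this single-conjunct summit

open CategoryTheory CategoryTheory.Limits AlgebraicGeometry Cardinal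
open Literature.AlgebraicGeometry.Resolution

namespace Summit.ResolutionOfSingularities.ResolutionOfSingularities.Theorems

/-- **Trichotomy-free form of "transcendence degree `≤ 1`".** A field `k` of characteristic `p` with
`Algebra.trdeg (⊥ : Subfield k) k ≤ 1` is perfect, or it contains a non-`p`-th power `t` and is algebraic over
`closure {t} = 𝔽_p(t)`: a non-`p`-th power is transcendental over the finite prime field (on the finite reduced
ring `𝔽_p[t]` Frobenius would be injective, hence onto), so `{t}` is a transcendence basis. [folklore] -/
theorem perfectField_or_exists_of_trdeg_le_one {p : ℕ} [Fact p.Prime] {k : Type} [Field k] [CharP k p]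
    (htr : Algebra.trdeg (⊥ : Subfield k) k ≤ 1) :
    PerfectField k ∨ ∃ t : k, (∀ s : k, s ^ p ≠ t) ∧
      Algebra.IsAlgebraic (Subfield.closure ({t} : Set k)) k := by
  classical
  have hp : p.Prime := Fact.out
  haveI : ExpChar k p := ExpChar.prime hp
  by_cases hperf : PerfectField k
  · exact Or.inl hperf
  right
  -- a non-`p`-th power
  obtain ⟨t, ht⟩ : ∃ t : k, ∀ s : k, s ^ p ≠ t := by
    by_contra h
    simp only [not_exists, not_forall, ne_eq, not_not] at h
    apply hperf
    haveI := PerfectRing.ofSurjective k p fun x => by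
      obtain ⟨s, hs⟩ := h x
      exact ⟨s, by rw [frobenius_def]; exact hs⟩
    exact PerfectRing.toPerfectField k p
  refine ⟨t, ht, ?_⟩
  -- the finite prime field
  set F0 : Subfield k := ⊥ with hF0
  haveI : Finite F0 := by
    letI := Subfield.fintypeBot k p
    exact Finite.of_fintype (⊥ : Subfield k)
  -- `t` is transcendental over `F0`
  have htrans : Transcendental F0 t := by
    intro halg
    have hint : IsIntegral F0 t := halg.isIntegral
    let A : Subalgebra F0 k := Algebra.adjoin F0 ({t} : Set k)
    have hfg : (Subalgebra.toSubmodule A).FG := hint.fg_adjoin_singleton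
    haveI : Module.Finite F0 (Subalgebra.toSubmodule A) :=
      Module.Finite.iff_fg.mpr hfg
    have hfinA : Finite (Subalgebra.toSubmodule A) := Module.finite_of_finite F0
    haveI : Finite A := Finite.of_injective
      (fun a : A => (⟨a.1, a.2⟩ : Subalgebra.toSubmodule A)) fun a b hab => by
        exact Subtype.ext (congrArg Subtype.val hab)
    haveI : CharP A p := (algebraMap A k).charP Subtype.val_injective p
    haveI : ExpChar A p := ExpChar.prime hp
    have hinj : Function.Injective (frobenius A p) := frobenius_inj A p
    obtain ⟨s, hs⟩ := (Finite.injective_iff_surjective.mp hinj) ⟨t, Algebra.subset_adjoin rfl⟩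
    apply ht s
    have := congrArg Subtype.val hs
    simpa [frobenius_def] using this
  -- `{t}` is a transcendence basis of `k / F0`
  have hx : AlgebraicIndependent F0 ![t] :=
    algebraicIndependent_unique_type_iff.mpr (by simpa using htrans)
  have hB : IsTranscendenceBasis F0 ![t] :=
    hx.isTranscendenceBasis_of_trdeg_le_of_finite (by simpa using htr)
  have halg := hB.isAlgebraic_field
  -- `F0(t) ⊆ closure {t}`
  set K1 := IntermediateField.adjoin F0 (Set.range ![t]) with hK1
  have hle : K1.toSubfield ≤ Subfield.closure ({t} : Set k) := by
    rw [hK1, IntermediateField.adjoin_toSubfield, Subfield.closure_le]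
    rintro x (⟨y, rfl⟩ | hx)
    · exact (bot_le : (⊥ : Subfield k) ≤ Subfield.closure ({t} : Set k)) y.2
    · obtain ⟨i, rfl⟩ := hx
      exact Subfield.subset_closure (by simp)
  letI : Algebra K1 (Subfield.closure ({t} : Set k)) :=
    (Subfield.inclusion hle : K1.toSubfield →+* Subfield.closure ({t} : Set k)).toAlgebra
  haveI : IsScalarTower K1 (Subfield.closure ({t} : Set k)) k :=
    IsScalarTower.of_algebraMap_eq fun _ => rfl
  exact Algebra.IsAlgebraic.extendScalars (R := K1) (S := Subfield.closure ({t} : Set k))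
    (Subfield.inclusion hle).injective

/-- **Resolution over perfect fields ⇒ resolution over every ground field of transcendence degree `≤ 1` over
`𝔽_p`** (reduced separated schemes of finite type of any dimension). [folklore] -/
theorem hasResolution_of_perfectRes_of_trdeg_le_one (p : ℕ) [Fact p.Prime]
    (H : ∀ (κ : Type) [Field κ] [CharP κ p] [PerfectField κ] (Z : Scheme.{0}) (h : Z ⟶ Spec (.of κ)),
      IsSeparated h → LocallyOfFiniteType h → QuasiCompact h → IsReduced Z → Scheme.HasResolution Z)
    (k : Type) [Field k] [CharP k p] (htr : Algebra.trdeg (⊥ : Subfield k) k ≤ 1)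
    (X : Scheme.{0}) (f : X ⟶ Spec (.of k)) [IsSeparated f] [LocallyOfFiniteType f] [QuasiCompact f]
    [IsReduced X] : Scheme.HasResolution X :=
  descentPerfectToAll_trdegLEOne p H k (perfectField_or_exists_of_trdeg_le_one htr) X f

/-- **The transcendence-degree-`≤ 1` layer of the crux `DescentPerfectToAll`, proved** (binder shape of
stmt-0549 with the hypothesis `Algebra.trdeg (⊥ : Subfield k) k ≤ 1` inserted). [folklore] -/
theorem descentPerfectToAll_trdeg_le_one :
    ∀ p : ℕ, p.Prime → (∀ (k : Type) [Field k] [CharP k p] [PerfectField k] (X : Scheme.{0})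
      (f : X ⟶ Spec (.of k)), IsSeparated f → LocallyOfFiniteType f → QuasiCompact f →
        IsReduced X → Scheme.HasResolution X) →
    ∀ (k : Type) [Field k] [CharP k p], Algebra.trdeg (⊥ : Subfield k) k ≤ 1 →
      ∀ (X : Scheme.{0}) (f : X ⟶ Spec (.of k)),
        IsSeparated f → LocallyOfFiniteType f → QuasiCompact f → IsReduced X →
          Scheme.HasResolution X := by
  intro p hp H k _ _ htr X f _ _ _ _
  haveI : Fact p.Prime := ⟨hp⟩
  exact hasResolution_of_perfectRes_of_trdeg_le_one p (fun κ _ _ _ Z h a b c d => H κ Z h a b c d)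
    k htr X f

end Summit.ResolutionOfSingularities.ResolutionOfSingularities.Theorems

end
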